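import Literature.NumberTheory.GelbartRogawski1991.FinLocalSplittingsSplitSphericalCoeff
import Literature.NumberTheory.GelbartRogawski1991.FinLocalSplittingsSplitSphericalDarboux
import HarnessLib

/-!
# The spherical matrix coefficients at the SPLIT places for every `L²`-isometric family of local splittings — the `∀ᶠ v` assembly

Topic `NumberTheory/GelbartRogawski1991`; namespace
`Literature.NumberTheory.GelbartRogawski1991.UnitaryDualPair.LocalSplitting.FinLocalSplittings`.  KERNEL ONLY: theorems, no definition, no
named fact, no `sorry`.  Sequel of `FinLocalSplittingsSplitSphericalCoeff.lean` (the per-place statement from Darboux data) and of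
`FinLocalSplittingsSplitSphericalDarboux.lean` (the Darboux data `γ_w = splitDarboux`, `t = splitCoord` at a split place,
[MoeglinVignerasWaldspurger1987, Chap. 2 III.1]); the pattern is ★ `eventually_forall_exists_shift_basis(_of_darboux)` verbatim, with the
shift basis replaced by its matrix coefficients:

* `eventually_forall_exists_unit_sphericalCoeff_of_darboux` — the `∀ᶠ v` assembly from Darboux data of the stated shape;
* **`eventually_forall_exists_unit_sphericalCoeff`** — for EVERY restricted family `𝓢` of local splittings over the embeddings `ι_v`
  ([GelbartRogawski1991, §3.1 Prop. 3.1.1]) whose local Weil representations are `L²(μ'_v{}^N)`-isometric (`hL2`; the CM families: ★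
  `isL2Isometric_omegaLoc_finLocalSplittingsCM`): for all but finitely many `v`, at every split `w ∣ v` and every generator `z₀` of
  `U(J₁)(F_v)/U(J₁)(𝒪_v)`, there is `u ∈ ℂ`, `|u| = 1`, with
  `∫ (ω_v(z₀^j · 1_N) 1_{𝒪_vᴺ}) conj 1_{𝒪_vᴺ} dμ'_vᴺ = μ'_vᴺ(𝒪_vᴺ) · u^j · ((√(q_v^N))⁻¹)^{|j|}` for all `j ∈ ℤ` — the hypothesis `hcoef` of
  ★ `Li1992/RallisLocalFactorSplitUnramified` at almost every split place: the split unramified LOCAL FACTOR of [Li1992, Thm 2.1 (27)] for the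
  pair `(U(J), U(J₁))` is `vol(U(J₁)(𝒪_v)) · μ(𝒪_vᴺ) · (1 − q_v^{-N}) ∕ |1 − u conj χ_v(z₀) q_v^{-N/2}|² ≠ 0`.

Cell hodgecm-mathlib, FLOOR 0, programme P4 (F4), crux item H413 (`--supports stmt-HodgeConjecture-24833`).  HC_CM is proved only modulo the
printed citations until rung 0 closes; nothing here is a claim about them.

## References
* [GelbartRogawski1991] S. Gelbart, J. Rogawski, Invent. Math. 105 (1991), §3.1 (3.1.3) p. 456, §3.2 p. 457.
* [MoeglinVignerasWaldspurger1987] C. Mœglin, M.-F. Vignéras, J.-L. Waldspurger, LNM 1291 (1987), Chap. 2 II.10, III.1.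
* [Li1992] J.-S. Li, J. reine angew. Math. 428 (1992), Thm 2.1 (27) p. 184; §5 p. 206.
-/

set_option autoImplicit false

noncomputable section

open scoped Matrix NNReal ValuativeRel ComplexConjugate
open NumberField IsDedekindDomain Filter Set MeasureTheory
open Literature.NumberTheory.Automorphic Literature.NumberTheory.Automorphic.UnitaryGroup
open Literature.RepresentationTheory Literature.RepresentationTheory.HeisenbergGroup
open Literature.NumberTheory.GaloisRepresentations.IsNonarchimedeanLocalField

namespace Literature.NumberTheory.GelbartRogawski1991.UnitaryDualPair.LocalSplitting.FinLocalSplittings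

variable {F : Type} [Field F] [NumberField F] {E : Type} [Field E] [NumberField E] [Algebra F E]
  [Algebra.IsQuadraticExtension F E] {c : E ≃ₐ[F] E} {N : ℕ} {δ : E} {hcδ : c δ = -δ} {hδ : δ ≠ 0} {d : F}
  {hd : δ * δ = algebraMap F E d} {T : Matrix (Fin N) (Fin N) F} {hT : T.IsSymm}
  {J : Matrix (Fin N) (Fin N) E} {hJ : J = T.map (algebraMap F E)}
  (𝓢 : FinLocalSplittings F E c N hcδ hδ hd T hT hJ) (J₁ : Matrix (Fin 1) (Fin 1) E) (hJ₁ : J₁ 0 0 ≠ 0)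
  (hTd : IsUnit T.det)
  [∀ v : HeightOneSpectrum (𝓞 F), MeasurableSpace (v.adicCompletion F)] [∀ v : HeightOneSpectrum (𝓞 F), BorelSpace (v.adicCompletion F)]
  (μ' : ∀ v : HeightOneSpectrum (𝓞 F), Measure (v.adicCompletion F)) [∀ v, (μ' v).IsAddHaarMeasure]

include hTd in
/-- **the `∀ᶠ v` assembly from split-place Darboux data** (the pattern of ★ `eventually_forall_exists_shift_basis_of_darboux`): for Darboux data
`γ_{v,w}`, `t_{v,w}` of the stated shape and an `L²`-isometric family, at almost every `v`, every split `w ∣ v` and every generator `z₀` the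
spherical matrix coefficients along `z₀` are `μ'_vᴺ(𝒪_vᴺ) · u^j · ((√(q_v^N))⁻¹)^{|j|}`, `|u| = 1`.
[cite: GelbartRogawski1991, §3.1 (3.1.3) p. 456, §3.2 p. 457] [cite: MoeglinVignerasWaldspurger1987, Chap. 2 II.10, III.1] -/
theorem eventually_forall_exists_unit_sphericalCoeff_of_darboux [NeZero N]
    (γ : ∀ (v : HeightOneSpectrum (𝓞 F)) (w : PlacesOver E v), c • w.1 ≠ w.1 → LocalSp F N T v)
    (t : ∀ (v : HeightOneSpectrum (𝓞 F)), PlacesOver E v → localPi E c 1 J₁ v → v.adicCompletion F)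
    (hγ : ∀ᶠ v : HeightOneSpectrum (𝓞 F) in cofinite, ∀ (w : PlacesOver E v) (hw : c • w.1 ≠ w.1),
      ∀ p ∈ (piPrimePowBall (v.adicCompletion F) (Fin N) 0) ×ˢ (piPrimePowBall (v.adicCompletion F) (Fin N) 0),
        (γ v w hw : ((Fin N → v.adicCompletion F) × (Fin N → v.adicCompletion F)) ≃ₗ[v.adicCompletion F]
          ((Fin N → v.adicCompletion F) × (Fin N → v.adicCompletion F))) p ∈
          (piPrimePowBall (v.adicCompletion F) (Fin N) 0) ×ˢ (piPrimePowBall (v.adicCompletion F) (Fin N) 0))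
    (ht : ∀ (v : HeightOneSpectrum (𝓞 F)) (w : PlacesOver E v), c • w.1 ≠ w.1 → ∀ z : localPi E c 1 J₁ v,
      Valued.v (t v w z) =
        Valued.v ((((z : localPi E c 1 J₁ v) : LocalGLPi E 1 v) w : Matrix (Fin 1) (Fin 1) (w.1.adicCompletion E)) 0 0))
    (hcenter : ∀ (v : HeightOneSpectrum (𝓞 F)) (w : PlacesOver E v) (hw : c • w.1 ≠ w.1) (z : localPi E c 1 J₁ v)
      (a₀ : GL (Fin N) (v.adicCompletion F)), (a₀ : Matrix (Fin N) (Fin N) (v.adicCompletion F)) = t v w z • 1 →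
      iota F E c N hcδ hδ hd T hT hJ v (localCenter E c N J J₁ hJ₁ v z) =
        (γ v w hw)⁻¹ * SymplecticMatrix.transportSp (localGram F N T v) (isUnit_det_localGram F N T hTd v)
          (SymplecticMatrix.levi a₀) * γ v w hw)
    (hgen : ∀ᶠ v : HeightOneSpectrum (𝓞 F) in cofinite, ∀ w : PlacesOver E v, c • w.1 ≠ w.1 →
      ∀ z₀ : localPi E c 1 J₁ v,
        (∀ h : localPi E c 1 J₁ v, ∃ (k₀ : localPi E c 1 J₁ v) (m : ℤ), k₀ ∈ localInt E c 1 J₁ v ∧ h = k₀ * z₀ ^ m) →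
        Valued.v ((((z₀ : localPi E c 1 J₁ v) : LocalGLPi E 1 v) w : Matrix (Fin 1) (Fin 1) (w.1.adicCompletion E)) 0 0) =
            WithZero.exp (-1) ∨
          Valued.v ((((z₀ : localPi E c 1 J₁ v) : LocalGLPi E 1 v) w : Matrix (Fin 1) (Fin 1) (w.1.adicCompletion E)) 0 0) =
            WithZero.exp 1)
    (hL2 : ∀ v : HeightOneSpectrum (𝓞 F), (𝓢.omegaLoc v).IsL2Isometric (Measure.pi fun _ : Fin N => μ' v)) :
    ∀ᶠ v : HeightOneSpectrum (𝓞 F) in cofinite, ∀ w : PlacesOver E v, c • w.1 ≠ w.1 →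
      ∀ z₀ : localPi E c 1 J₁ v,
        (∀ h : localPi E c 1 J₁ v, ∃ (k₀ : localPi E c 1 J₁ v) (m : ℤ), k₀ ∈ localInt E c 1 J₁ v ∧ h = k₀ * z₀ ^ m) →
        ∃ u : ℂ, ‖u‖ = 1 ∧ ∀ j : ℤ,
          ∫ x, ((𝓢.omegaLoc v (localCenter E c N J J₁ hJ₁ v (z₀ ^ j)) (unitVec F (Fin N) v) :
                SchwartzBruhat (Fin N → v.adicCompletion F)) : (Fin N → v.adicCompletion F) → ℂ) x *
              conj (((unitVec F (Fin N) v : SchwartzBruhat (Fin N → v.adicCompletion F)) : (Fin N → v.adicCompletion F) → ℂ) x)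
              ∂(Measure.pi fun _ : Fin N => μ' v) =
            ((Measure.pi fun _ : Fin N => μ' v).real (piPrimePowBall (v.adicCompletion F) (Fin N) 0) : ℂ) * u ^ j *
              (((Real.sqrt ((residueFieldCard (v.adicCompletion F) : ℝ) ^ Fintype.card (Fin N)))⁻¹ : ℝ) : ℂ) ^ j.natAbs := by
  filter_upwards [eventually_hasConductorExp_zero_adicComponent_adeleAddChar (K := F), eventually_invOf_two_mem F,
    eventually_forall_entry_mem F T, eventually_forall_localGram_inv_mem hTd, hγ, hgen] with v hcond h2 hTi hTi' hγv hgv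
  intro w hw z₀ hz₀
  exact 𝓢.forall_exists_unit_sphericalCoeff_of_darboux J₁ hJ₁ hTd v hcond h2 (fun i j => (mem_primePowBall_zero_iff _).2 (hTi i j)) hTi'
    w (γ v w hw) (hγv w hw) (t v w) (ht v w hw) (hcenter v w hw) (hgv w hw) (μ' v) (hL2 v) z₀ hz₀

include hTd in
/-- **THE SPHERICAL MATRIX COEFFICIENTS AT THE SPLIT PLACES, FOR EVERY `L²`-ISOMETRIC RESTRICTED FAMILY OF LOCAL SPLITTINGS** — the hypothesis
`hcoef` of ★ `Li1992/RallisLocalFactorSplitUnramified.integral_localFactor_unitVec(_ne_zero)_of_sphericalCoeff` as a THEOREM: for all but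
finitely many `v`, at every `w ∣ v` split in `E` and every generator `z₀` of `U(J₁)(F_v)` modulo `U(J₁)(𝒪_v)`, there is `u ∈ ℂ`, `|u| = 1`, with
`∫ (ω_v(z₀^j · 1_N) 1_{𝒪_vᴺ}) conj 1_{𝒪_vᴺ} dμ'_vᴺ = μ'_vᴺ(𝒪_vᴺ) · u^j · ((√(q_v^N))⁻¹)^{|j|}` (Darboux data of ★ `LocalUnitarySplitPlaceDarboux`
fed into `eventually_forall_exists_unit_sphericalCoeff_of_darboux`).
[cite: GelbartRogawski1991, §3.1 (3.1.3) p. 456, §3.2 p. 457] [cite: MoeglinVignerasWaldspurger1987, Chap. 2 II.10, III.1] [cite: Li1992, Thm 2.1 (27) p. 184] -/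
theorem eventually_forall_exists_unit_sphericalCoeff [NeZero N] (hJ₁c : (J₁.map c)ᵀ = J₁)
    (hL2 : ∀ v : HeightOneSpectrum (𝓞 F), (𝓢.omegaLoc v).IsL2Isometric (Measure.pi fun _ : Fin N => μ' v)) :
    ∀ᶠ v : HeightOneSpectrum (𝓞 F) in cofinite, ∀ w : PlacesOver E v, c • w.1 ≠ w.1 →
      ∀ z₀ : localPi E c 1 J₁ v,
        (∀ h : localPi E c 1 J₁ v, ∃ (k₀ : localPi E c 1 J₁ v) (m : ℤ), k₀ ∈ localInt E c 1 J₁ v ∧ h = k₀ * z₀ ^ m) →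
        ∃ u : ℂ, ‖u‖ = 1 ∧ ∀ j : ℤ,
          ∫ x, ((𝓢.omegaLoc v (localCenter E c N J J₁ hJ₁ v (z₀ ^ j)) (unitVec F (Fin N) v) :
                SchwartzBruhat (Fin N → v.adicCompletion F)) : (Fin N → v.adicCompletion F) → ℂ) x *
              conj (((unitVec F (Fin N) v : SchwartzBruhat (Fin N → v.adicCompletion F)) : (Fin N → v.adicCompletion F) → ℂ) x)
              ∂(Measure.pi fun _ : Fin N => μ' v) =
            ((Measure.pi fun _ : Fin N => μ' v).real (piPrimePowBall (v.adicCompletion F) (Fin N) 0) : ℂ) * u ^ j *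
              (((Real.sqrt ((residueFieldCard (v.adicCompletion F) : ℝ) ^ Fintype.card (Fin N)))⁻¹ : ℝ) : ℂ) ^ j.natAbs := by
  have hc : c ≠ 1 := by
    rintro rfl
    exact hδ (self_eq_neg.1 (by simpa only [AlgEquiv.one_apply] using hcδ))
  refine 𝓢.eventually_forall_exists_unit_sphericalCoeff_of_darboux J₁ hJ₁ hTd μ'
    (fun v w hw => splitDarboux F E c N hcδ hδ hd T v hT w hw)
    (fun v w z => splitCoord F E c hcδ hδ v w fun w' =>
      (((z : LocalGLPi E 1 v) w' : GL (Fin 1) (w'.1.adicCompletion E)) : Matrix (Fin 1) (Fin 1) (w'.1.adicCompletion E)) 0 0)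
    ?_ (fun v w hw z => valued_splitCoord F E c hcδ hδ hd v w hw _) ?_ ?_ hL2
  · -- `γ_w` preserves the box: `2` and `δ_w` are units
    filter_upwards [eventually_valued_two_eq_one (F := F),
      eventually_forall_valued_splitSqrt_eq_one F E c hcδ hδ hd] with v h2 hδv w hw
    exact splitDarboux_mapsTo F E c N hcδ hδ hd T v hT w hw h2 (hδv w hw)
  · -- the centre is the conjugated scalar Levi element
    intro v w hw z a₀ ha₀
    exact iota_localCenter_eq F E c N hcδ hδ hd T hJ v hT hTd (isUnit_det_localGram F N T hTd v) w hw hJ₁ z a₀ ha₀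
  · -- orientation of generators
    filter_upwards [eventually_forall_placesOver_valued_eq_one (F := F) (J₁ 0 0) hJ₁] with v hj w hw z₀ hz₀
    exact valued_entry_eq_exp_or_of_generates F E c v hc hJ₁c w hw (hj w) z₀ hz₀

end Literature.NumberTheory.GelbartRogawski1991.UnitaryDualPair.LocalSplitting.FinLocalSplittings

end
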